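import Mathlib
import Summits.ValiantsHypothesis.ValiantsHypothesis.Theses.NewtonUnitEquations

/-!
# `TwoProducts` (stmt-ValiantsHypothesis-5906) — negative side: the RANK obstruction behind "≤ 2m hidden
# vertices per non-critical interval on a common tail cone"

Standing disprover (cdisprove, cycle 1), extracted from `Cruxes/TwoProducts/Disproof.lean` §4 (obstruction F4 of
its §3 ledger; the same linear algebra is the "LRS of order ≤ 2m / (2m+1)×(2m+1) grid" step of the ideator line
`formal-log-linearisation`).  After localising `W = ∏f − ∏g` at a cancelling corner and taking logarithms, the
coefficient of `S^pT^q` in `Λ = Σ_j log(1+α_jS+β_jT) − Σ_j log(1+α'_jS+β'_jT)` is `c_pq·G(p,q)` with `c_pq ≠ 0` and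
`G(p,q) = Σ_{j<2m} ε_j α_j^p β_j^q` — a pattern of rank `≤ 2m`; hidden vertices are minimal nonzeros of `G`.

* `card_corners_le_rank` — a rank-`≤ r` pattern `G p q = Σ_{j<r} a_j(p) b_j(q)` has at most `r` points
  `(p_i,q_i)` with `G(p_i,q_i) ≠ 0` and `G(p_i,q_k) = 0` for `i < k` (lower-triangular invertible minor factoring
  through `Fin r`);
* `card_minimal_nonzeros_le_rank` — geometric form (minimal nonzeros, `p` strictly increasing);
* `card_corners_le_of_expSum` — the exponential-sum instance;
* `corners_rank_tight` — `r` corners are attained (anti-diagonal pattern), so the count is sharp within the method.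
Elementary linear algebra (Mathlib `Matrix.rank`, `det_of_lowerTriangular`). [folklore]
-/

set_option linter.dupNamespace false

namespace Summit.ValiantsHypothesis.ValiantsHypothesis.Theorems.TwoProducts.Negative

open scoped BigOperators

/-! ## The rank obstruction

Used on every non-critical interval whose `2m` normalised factors share one tail cone (and by the
`formal-log-linearisation` line: "each row is an LRS of order ≤ 2m … hidden vertices lie in a (2m+1)×(2m+1)
grid"): the coefficient pattern `G(p,q) = Σ_{j<r} a_j(p)·b_j(q)` (for two products `r = 2m`,
`a_j(p) = ε_jα_j^p`, `b_j(q) = β_j^q`) has at most `r` minimal nonzeros, hence the Newton polygon of `Λ_I` has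
at most `r` vertices inside the interval.  Pure linear algebra: the `V×V` matrix `(G(p_i,q_k))` on the corners is
lower triangular with nonzero diagonal, so it is invertible, and it factors through `Fin r`. -/

/-- **Rank obstruction (staircase corners of a low-rank zero pattern).**  If `G p q = ∑_{j<r} a_j(p) b_j(q)`
and `(p_i, q_i)_{i<V}` satisfy `G (p_i) (q_i) ≠ 0` but `G (p_i) (q_k) = 0` whenever `i < k` (the pattern of the
outer corners `p_0 < p_1 < ⋯`, `q_0 > q_1 > ⋯` of a down-set of zeros), then `V ≤ r`. [folklore] -/
theorem card_corners_le_rank {K : Type*} [Field K] {r V : ℕ} (a b : Fin r → ℕ → K) (G : ℕ → ℕ → K)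
    (hG : ∀ p q, G p q = ∑ j, a j p * b j q) (p q : Fin V → ℕ)
    (hdiag : ∀ i, G (p i) (q i) ≠ 0) (hupper : ∀ i k, i < k → G (p i) (q k) = 0) : V ≤ r := by
  classical
  let M : Matrix (Fin V) (Fin V) K := fun i k => G (p i) (q k)
  let A : Matrix (Fin V) (Fin r) K := fun i j => a j (p i)
  let B : Matrix (Fin r) (Fin V) K := fun j k => b j (q k)
  have hM : M = A * B := by
    ext i k
    simp only [M, A, B, Matrix.mul_apply, hG]
  have htri : M.BlockTriangular OrderDual.toDual := fun i k hik => hupper i k (by simpa using hik)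
  have hdet : M.det ≠ 0 := by
    rw [Matrix.det_of_lowerTriangular M htri]
    exact Finset.prod_ne_zero_iff.2 (fun i _ => hdiag i)
  have hunit : IsUnit M := (Matrix.isUnit_iff_isUnit_det M).2 (isUnit_iff_ne_zero.2 hdet)
  have h1 : M.rank = V := by rw [Matrix.rank_of_isUnit M hunit, Fintype.card_fin]
  have h2 : M.rank ≤ r := by
    rw [hM]
    exact (Matrix.rank_mul_le_left A B).trans (by simpa using Matrix.rank_le_card_width A)
  omega

/-- Geometric form: minimal nonzeros of a rank-`≤ r` pattern (points `x_i = (p_i,q_i)`, `p` strictly increasing,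
`G ≠ 0` at `x_i`, `G = 0` at every lattice point weakly below `x_i` other than `x_i`) number at most `r`.
(For two products `G 0 0 = Σ_j ε_j = 0`, so the outer corners of the maximal down-set of zeros qualify.) [folklore] -/
theorem card_minimal_nonzeros_le_rank {K : Type*} [Field K] {r V : ℕ} (a b : Fin r → ℕ → K) (G : ℕ → ℕ → K)
    (hG : ∀ p q, G p q = ∑ j, a j p * b j q) (p q : Fin V → ℕ) (hp : StrictMono p)
    (hne : ∀ i, G (p i) (q i) ≠ 0)
    (hbelow : ∀ i p' q', p' ≤ p i → q' ≤ q i → (p', q') ≠ (p i, q i) → G p' q' = 0) : V ≤ r :=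
  card_corners_le_rank a b G hG p q hne fun i k hik =>
    hbelow k (p i) (q k) (hp hik).le le_rfl fun h => by
      have h1 := (Prod.mk.inj h).1
      have h2 := hp hik
      omega

/-- The exponential-sum instance (two products on a common tail cone, `r = 2m`): a signed sum of `r` planar
monomial characters `G p q = ∑_j ε_j α_j^p β_j^q` has at most `r` staircase corners in its zero pattern. [folklore] -/
theorem card_corners_le_of_expSum {K : Type*} [Field K] {r V : ℕ} (ε α β : Fin r → K) (G : ℕ → ℕ → K)
    (hG : ∀ p q, G p q = ∑ j, ε j * α j ^ p * β j ^ q) (p q : Fin V → ℕ)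
    (hdiag : ∀ i, G (p i) (q i) ≠ 0) (hupper : ∀ i k, i < k → G (p i) (q k) = 0) : V ≤ r :=
  card_corners_le_rank (fun j p => ε j * α j ^ p) (fun j q => β j ^ q) G hG p q hdiag hupper

/-- TIGHTNESS of the rank obstruction: `r` corners do occur for rank `r` — the anti-diagonal pattern
`G p q = Σ_{j<r} [p = j]·[q = r-1-j]` has the `r` corners `(i, r-1-i)` (nonzero there, zero at `(i, r-1-k)` for
`i < k`).  So "≤ 2m vertices per interval" cannot be improved inside the rank argument alone. [folklore] -/
theorem corners_rank_tight (r : ℕ) :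
    ∃ (a b : Fin r → ℕ → ℚ) (p q : Fin r → ℕ), StrictMono p ∧
      (∀ i, (∑ j, a j (p i) * b j (q i)) ≠ 0) ∧ (∀ i k, i < k → (∑ j, a j (p i) * b j (q k)) = 0) := by
  classical
  refine ⟨fun j p => if p = j then 1 else 0, fun j q => if q = r - 1 - j then 1 else 0,
    fun i => i, fun i => r - 1 - i, fun i k h => h, fun i => ?_, fun i k hik => ?_⟩
  · rw [Finset.sum_eq_single i]
    · simp
    · intro j _ hji
      have : (i : ℕ) ≠ j := fun h => hji (Fin.ext h).symm
      simp [this]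
    · simp
  · refine Finset.sum_eq_zero fun j _ => ?_
    by_cases h1 : (i : ℕ) = j
    · have hk : (r - 1 - (k : ℕ)) ≠ r - 1 - (j : ℕ) := by
        have := k.isLt; have := j.isLt; have : (i : ℕ) < k := hik; omega
      simp [h1, hk]
    · simp [h1]


end Summit.ValiantsHypothesis.ValiantsHypothesis.Theorems.TwoProducts.Negative
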